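import Summits.MatrixMultiplication.MatrixMultiplication.Theorems.SaturationLadderLevelTwoWord
import Literature.Computability.AlgebraicComplexity.BigCwSquareOmega
import Summits.MatrixMultiplication.MatrixMultiplication.Theorems.SaturationLadderPooledAlpha517

/-!
# Level 2 of the saturation ladder — II: `ω(1, 3/10, 1) = 2`, `α ≥ 0.3`
# (route `SaturationLadder`, lens 1, gen 21)

Cell `decomp-mm`, lens 1 («grading / quantitative ladder»), gen 21, part 2 of 2.  No named
facts, no sorry; the one definition is the law of the word of part 1
(`SaturationLadderLevelTwoWord`).  This file runs the outer laser method ON THE VALUED WORD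
`lvl2Word` over `CW_5^{⊗2}` (`laserMethod_hasFormatValue_of_wordValue`, `LaserFormatWordValue`;
labels `cwLev2`, support `cwSupport₂`, tightness `cwTight₂` with `r = 1`, `b = 4`): the law of
the word is of product form on the support (penalty `Γ = 0`, `maxEntropyPenalty_eq_zero_of_mul`;
factors `n_{IJL} = f(I) g(J) g(L)` with `f = (45369/1156, 15123/68, 426, 230, 46)`,
`g = (1, 1, 68/71, 1156/15123, 2312/45369)`), its `x`-marginal is `(1,10,27,10,1)/49` and its
`y`-, `z`-marginals `(703,872,657,20,2)/2254` have larger entropy (integer certificate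
`49^2254 · ∏ u^u ≤ 2254^2254 · 10^920 · 27^1242`), and with `q = 5` the packing bound
SATURATES EXACTLY: `2^{H_x} · W · A² = 49 ≥ R̃(CW_5^{⊗2})`, where `W, A, B` are the per-position
value and formats of the word (`A^{3/10} ≤ B` by the integer certificate
`2^18387 · 3^69984 ≤ 5^55950`).
Hence **`ω(1, 3/10, 1) = 2` and `α ≥ 3/10`** (`omegaRect_one_3_10_one`, `alpha_ge_3_10`; the
tree record was `5/17 = 0.29411…`; Le Gall 2012 obtains `α > 0.30298` from the same level with
real-optimal parameters, and `0.31389` from level 4).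

Bookkeeping against the g20 instrument (`level2_lg21.py`, LG mode): `q = 5`, `D = 46`,
`k* = 0.30053`, `H_x = 1.135916`, `H_y = H_z = 1.138273` nats, `τ = 25/27`.

## References

* F. Le Gall, *Faster algorithms for rectangular matrix multiplication*, FOCS 2012,
  arXiv:1204.1111, §3, §6.1, Prop. 6.2, Table 2. [LeGall2012]
* D. Coppersmith, S. Winograd, *Matrix multiplication via arithmetic progressions*,
  J. Symbolic Comput. 9 (1990), §8. [CoppersmithWinograd1990]
* D. Coppersmith, *Rectangular matrix multiplication revisited*, J. Complexity 13 (1997), §3.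
  [Coppersmith1997]
* F. Le Gall, *Powers of tensors and fast matrix multiplication*, ISSAC 2014, arXiv:1401.7714,
  Thm. 4.1 and Appendix A.3. [LeGall2014]
-/

set_option linter.dupNamespace false
set_option autoImplicit false
set_option exponentiation.threshold 100000
set_option maxRecDepth 100000

noncomputable section

open Finset Real
open scoped BigOperators

namespace Summit.MatrixMultiplication.MatrixMultiplication.Theorems.SaturationLadderLevelTwo

open Literature.Computability.AlgebraicComplexity
open Literature.Barriers.MatrixMultiplication (bigCwTensor)

/-! ## The law of the word: product form, penalty zero, marginal entropies -/

/-- **The law of the word** (its type divided by its length). [folklore] -/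
def lvl2Law (s : PL5) : ℝ := (letterCount lvl2Word s : ℝ) / 2254

/-- The law, with the length as a cast natural. [folklore] -/
theorem lvl2Law_eq (s : PL5) :
    lvl2Law s = (letterCount lvl2Word s : ℝ) / ((2254 : ℕ) : ℝ) := by
  rw [lvl2Law]; simp only [Nat.cast_ofNat]

/-- The law vanishes off the support. [folklore] -/
theorem lvl2Law_eq_zero (s : PL5) (hs : s ∉ cwSupport₂) : lvl2Law s = 0 := by
  rw [lvl2Law, letterCount_eq_zero_of_forall_mem lvl2Word_mem s hs]; simp

/-- The law is nonnegative. [folklore] -/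
theorem lvl2Law_nonneg (s : PL5) : 0 ≤ lvl2Law s := by unfold lvl2Law; positivity

/-- The law sums to one. [folklore] -/
theorem sum_lvl2Law : ∑ s, lvl2Law s = 1 := by
  show ∑ s, (letterCount lvl2Word s : ℝ) / 2254 = 1
  rw [← Finset.sum_div, ← Nat.cast_sum, sum_letterCount lvl2Word]
  norm_num

/-- The law is a probability vector. [folklore] -/
theorem lvl2Law_mem_stdSimplex : lvl2Law ∈ stdSimplex ℝ PL5 := ⟨lvl2Law_nonneg, sum_lvl2Law⟩

/-- All literal disequalities in `Fin 5`, as `simp` lemmas (`norm_num` does not decide `4 = 0`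
in `Fin 5` by itself). [folklore] -/
theorem fin5_lits :
    ((0 : Fin 5) = 1 ↔ False) ∧
    ((0 : Fin 5) = 2 ↔ False) ∧
    ((0 : Fin 5) = 3 ↔ False) ∧
    ((0 : Fin 5) = 4 ↔ False) ∧
    ((1 : Fin 5) = 0 ↔ False) ∧
    ((1 : Fin 5) = 2 ↔ False) ∧
    ((1 : Fin 5) = 3 ↔ False) ∧
    ((1 : Fin 5) = 4 ↔ False) ∧
    ((2 : Fin 5) = 0 ↔ False) ∧
    ((2 : Fin 5) = 1 ↔ False) ∧
    ((2 : Fin 5) = 3 ↔ False) ∧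
    ((2 : Fin 5) = 4 ↔ False) ∧
    ((3 : Fin 5) = 0 ↔ False) ∧
    ((3 : Fin 5) = 1 ↔ False) ∧
    ((3 : Fin 5) = 2 ↔ False) ∧
    ((3 : Fin 5) = 4 ↔ False) ∧
    ((4 : Fin 5) = 0 ↔ False) ∧
    ((4 : Fin 5) = 1 ↔ False) ∧
    ((4 : Fin 5) = 2 ↔ False) ∧
    ((4 : Fin 5) = 3 ↔ False) := by
  decide

/-- The `x`-factor of the product form of the counts (divided by the length). [folklore] -/
def fX (i : Fin 5) : ℝ :=
  (if i = 0 then 45369 / 1156 else if i = 1 then 15123 / 68 else if i = 2 then 426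
    else if i = 3 then 230 else 46) / 2254

/-- The `y`- and `z`-factor of the product form of the counts. [folklore] -/
def gY (j : Fin 5) : ℝ :=
  if j = 0 then 1 else if j = 1 then 1 else if j = 2 then 68 / 71 else if j = 3 then 1156 / 15123
    else 2312 / 45369

/-- The `x`-factor is positive. [folklore] -/
theorem fX_pos (i : Fin 5) : 0 < fX i := by unfold fX; split_ifs <;> norm_num
/-- The `y`-factor is positive. [folklore] -/
theorem gY_pos (j : Fin 5) : 0 < gY j := by unfold gY; split_ifs <;> norm_num

/-- **The law is of product form on the support**: `n_{IJL} = f(I) g(J) g(L)`. [folklore] -/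
theorem lvl2Law_prod : ∀ x ∈ cwSupport₂, lvl2Law x = fX x.1 * gY x.2.1 * gY x.2.2 := by
  intro x hx
  rw [cwSupport₂_eq] at hx
  simp only [Finset.mem_insert, Finset.mem_singleton] at hx
  rcases hx with rfl | rfl | rfl | rfl | rfl | rfl | rfl | rfl | rfl | rfl | rfl | rfl | rfl |
    rfl | rfl
  all_goals norm_num [lvl2Law, letterCount_lvl2Word, fX, gY, fin5_lits]

/-- **Penalty zero**: `Γ_S(P) = 0` for the law of the word.
[cite: LeGall2012, §6.1] [cite: CoppersmithWinograd1990, §8] -/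
theorem maxEntropyPenalty_lvl2Law : maxEntropyPenalty cwSupport₂ lvl2Law = 0 :=
  maxEntropyPenalty_eq_zero_of_mul cwSupport₂ lvl2Law_mem_stdSimplex lvl2Law_eq_zero fX gY gY
    (fun x _ => fX_pos x.1) (fun x _ => gY_pos x.2.1) (fun x _ => gY_pos x.2.2) lvl2Law_prod

/-- The `x`-marginal: `(46, 460, 1242, 460, 46)/2254 = (1, 10, 27, 10, 1)/49`. [folklore] -/
theorem marginalDist₁_lvl2Law :
    marginalDist₁ lvl2Law 0 = 1 / 49 ∧ marginalDist₁ lvl2Law 1 = 10 / 49 ∧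
      marginalDist₁ lvl2Law 2 = 27 / 49 ∧ marginalDist₁ lvl2Law 3 = 10 / 49 ∧
      marginalDist₁ lvl2Law 4 = 1 / 49 := by
  simp only [marginalDist₁_eq_sum_filter cwSupport₂ lvl2Law_eq_zero, cwSupport₂_eq]
  refine ⟨?_, ?_, ?_, ?_, ?_⟩ <;>
    norm_num [Finset.filter_insert, Finset.filter_singleton, lvl2Law, letterCount_lvl2Word,
      fin5_lits]

/-- The `y`-marginal: `(703, 872, 657, 20, 2)/2254`. [folklore] -/
theorem marginalDist₂_lvl2Law :
    marginalDist₂ lvl2Law 0 = 703 / 2254 ∧ marginalDist₂ lvl2Law 1 = 872 / 2254 ∧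
      marginalDist₂ lvl2Law 2 = 657 / 2254 ∧ marginalDist₂ lvl2Law 3 = 20 / 2254 ∧
      marginalDist₂ lvl2Law 4 = 2 / 2254 := by
  simp only [marginalDist₂_eq_sum_filter cwSupport₂ lvl2Law_eq_zero, cwSupport₂_eq]
  refine ⟨?_, ?_, ?_, ?_, ?_⟩ <;>
    norm_num [Finset.filter_insert, Finset.filter_singleton, lvl2Law, letterCount_lvl2Word,
      fin5_lits]

/-- The `z`-marginal: `(703, 872, 657, 20, 2)/2254`. [folklore] -/
theorem marginalDist₃_lvl2Law :
    marginalDist₃ lvl2Law 0 = 703 / 2254 ∧ marginalDist₃ lvl2Law 1 = 872 / 2254 ∧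
      marginalDist₃ lvl2Law 2 = 657 / 2254 ∧ marginalDist₃ lvl2Law 3 = 20 / 2254 ∧
      marginalDist₃ lvl2Law 4 = 2 / 2254 := by
  simp only [marginalDist₃_eq_sum_filter cwSupport₂ lvl2Law_eq_zero, cwSupport₂_eq]
  refine ⟨?_, ?_, ?_, ?_, ?_⟩ <;>
    norm_num [Finset.filter_insert, Finset.filter_singleton, lvl2Law, letterCount_lvl2Word,
      fin5_lits]

/-- `η(a/N) = (a ln N − a ln a)/N` for reals `a, N > 0`. [folklore] -/
theorem negMulLog_div' {a N : ℝ} (ha : 0 < a) (hN : 0 < N) :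
    negMulLog (a / N) = (a * Real.log N - a * Real.log a) / N := by
  rw [Real.negMulLog, Real.log_div ha.ne' hN.ne']
  field_simp
  ring

/-- `ln 2 · H` of a function on `Fin 5` is the sum of the five `η`'s. [folklore] -/
theorem log_two_mul_shannonEntropy_fin5 (m : Fin 5 → ℝ) :
    Real.log 2 * shannonEntropy m =
      negMulLog (m 0) + negMulLog (m 1) + negMulLog (m 2) + negMulLog (m 3) + negMulLog (m 4) := by
  have hlog : 0 < Real.log 2 := Real.log_pos one_lt_two
  rw [shannonEntropy_def, mul_div_cancel₀ _ hlog.ne', Fin.sum_univ_five]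

/-- **`ln 2 · H_x = ln 49 − (20 ln 10 + 27 ln 27)/49`.** [folklore] -/
theorem entropy₁_lvl2Law : Real.log 2 * shannonEntropy (marginalDist₁ lvl2Law) =
    Real.log 49 - (20 * Real.log 10 + 27 * Real.log 27) / 49 := by
  obtain ⟨e0, e1, e2, e3, e4⟩ := marginalDist₁_lvl2Law
  rw [log_two_mul_shannonEntropy_fin5, e0, e1, e2, e3, e4,
    negMulLog_div' (by norm_num) (by norm_num), negMulLog_div' (by norm_num) (by norm_num),
    negMulLog_div' (by norm_num) (by norm_num), Real.log_one]
  ring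

/-- **`ln 2 · H_y = ln 2254 − (703 ln 703 + 872 ln 872 + 657 ln 657 + 20 ln 20 + 2 ln 2)/2254`.**
[folklore] -/
theorem entropy₂_lvl2Law : Real.log 2 * shannonEntropy (marginalDist₂ lvl2Law) =
    Real.log 2254 - (703 * Real.log 703 + 872 * Real.log 872 + 657 * Real.log 657 +
      20 * Real.log 20 + 2 * Real.log 2) / 2254 := by
  obtain ⟨e0, e1, e2, e3, e4⟩ := marginalDist₂_lvl2Law
  rw [log_two_mul_shannonEntropy_fin5, e0, e1, e2, e3, e4,
    negMulLog_div' (by norm_num) (by norm_num), negMulLog_div' (by norm_num) (by norm_num),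
    negMulLog_div' (by norm_num) (by norm_num), negMulLog_div' (by norm_num) (by norm_num),
    negMulLog_div' (by norm_num) (by norm_num)]
  ring

/-- `ln 2 · H_z = ln 2 · H_y`. [folklore] -/
theorem entropy₃_lvl2Law : Real.log 2 * shannonEntropy (marginalDist₃ lvl2Law) =
    Real.log 2254 - (703 * Real.log 703 + 872 * Real.log 872 + 657 * Real.log 657 +
      20 * Real.log 20 + 2 * Real.log 2) / 2254 := by
  obtain ⟨e0, e1, e2, e3, e4⟩ := marginalDist₃_lvl2Law
  rw [log_two_mul_shannonEntropy_fin5, e0, e1, e2, e3, e4,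
    negMulLog_div' (by norm_num) (by norm_num), negMulLog_div' (by norm_num) (by norm_num),
    negMulLog_div' (by norm_num) (by norm_num), negMulLog_div' (by norm_num) (by norm_num),
    negMulLog_div' (by norm_num) (by norm_num)]
  ring

/-- Integer certificate: `49^2254 · ∏ u_y^{u_y} ≤ 2254^2254 · 10^920 · 27^1242`
(`H_x ≤ H_y`).
[folklore] -/
theorem cert_marginals :
    (49 : ℕ) ^ 2254 * (703 ^ 703 * 872 ^ 872 * 657 ^ 657 * 20 ^ 20 * 2 ^ 2) ≤
      2254 ^ 2254 * (10 ^ 920 * 27 ^ 1242) := by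
  decide

/-- **`H_x ≤ H_y`** (and `= H_z`): the minimum marginal entropy of the law is `H_x`. [folklore] -/
theorem entropy₁_le_entropy₂ :
    shannonEntropy (marginalDist₁ lvl2Law) ≤ shannonEntropy (marginalDist₂ lvl2Law) := by
  have hlog : 0 < Real.log 2 := Real.log_pos one_lt_two
  have h : ((49 : ℕ) ^ 2254 * (703 ^ 703 * 872 ^ 872 * 657 ^ 657 * 20 ^ 20 * 2 ^ 2) : ℝ) ≤
      (2254 : ℕ) ^ 2254 * (10 ^ 920 * 27 ^ 1242) := by exact_mod_cast cert_marginals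
  push_cast at h
  have h' := Real.log_le_log (by positivity) h
  rw [Real.log_mul (by positivity) (by positivity), Real.log_mul (by positivity) (by positivity),
    Real.log_mul (by positivity) (by positivity), Real.log_mul (by positivity) (by positivity),
    Real.log_mul (by positivity) (by positivity), Real.log_mul (by positivity) (by positivity),
    Real.log_mul (by positivity) (by positivity)] at h'
  simp only [Real.log_pow, Nat.cast_ofNat] at h'
  have e1 := entropy₁_lvl2Law
  have e2 := entropy₂_lvl2Law
  have key : Real.log 2 * shannonEntropy (marginalDist₁ lvl2Law) ≤
      Real.log 2 * shannonEntropy (marginalDist₂ lvl2Law) := by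
    rw [e1, e2]
    linarith [h']
  exact le_of_mul_le_mul_left key hlog

/-- `H_z = H_y`. [folklore] -/
theorem entropy₃_eq_entropy₂ :
    shannonEntropy (marginalDist₃ lvl2Law) = shannonEntropy (marginalDist₂ lvl2Law) := by
  have hlog : Real.log 2 ≠ 0 := (Real.log_pos one_lt_two).ne'
  have e := entropy₃_lvl2Law
  rw [← entropy₂_lvl2Law] at e
  exact mul_left_cancel₀ hlog e

/-- **The minimum marginal entropy of the law is `H_x`.** [folklore] -/
theorem min_entropy_lvl2Law :
    min (shannonEntropy (marginalDist₁ lvl2Law)) (min (shannonEntropy (marginalDist₂ lvl2Law))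
      (shannonEntropy (marginalDist₃ lvl2Law))) = shannonEntropy (marginalDist₁ lvl2Law) := by
  rw [entropy₃_eq_entropy₂]
  exact min_eq_left (le_min entropy₁_le_entropy₂ entropy₁_le_entropy₂)

/-! ## The packing bound at level 2 and the conclusion -/

/-- `R̃(CW_5^{⊗2}) ≤ 49` (sub-multiplicativity and the border-rank bound `R̃(CW_q) ≤ q+2`).
[cite: CoppersmithWinograd1990, §6 and §8] -/
theorem asymptoticRank_bigCwSq_five_le : asymptoticRank (bigCwSq ℂ 5) ≤ 49 := by
  have h := asymptoticRank_bigCwTensor_le ℂ 5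
  have h0 := asymptoticRank_nonneg (bigCwTensor ℂ 5)
  calc asymptoticRank (bigCwSq ℂ 5)
      ≤ asymptoticRank (bigCwTensor ℂ 5) * asymptoticRank (bigCwTensor ℂ 5) :=
        asymptoticRank_kronecker_le _ _
    _ ≤ 7 * 7 :=
        mul_le_mul (by norm_num at h; linarith) (by norm_num at h; linarith) h0 (by norm_num)
    _ = 49 := by norm_num

/-- Integer certificate: `2^18387 · 3^69984 ≤ 5^55950` (`A^{3/10} ≤ B` for the per-position
formats of the word). [folklore] -/
theorem cert_format : (2 : ℕ) ^ 18387 * 3 ^ 69984 ≤ 5 ^ 55950 := by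
  decide

/-- **Level 2 of the saturation ladder: `ω(1, 3/10, 1) ≤ 2`** (Le Gall 2012 §6 at `q = 5`, in
the tree's format currency, with the exactly saturating design `lvl2Word`).
[cite: LeGall2012, §6.1, Prop. 6.2 and Table 2] [cite: CoppersmithWinograd1990, §8]
[cite: Coppersmith1997, §3] -/
theorem omegaRect_one_3_10_one_le_two : omegaRect ℂ 1 ((3 : ℝ) / 10) 1 ≤ 2 := by
  -- per-position value and formats: the `2254`-th roots of the totals
  set W : ℝ := Vtot ^ (((2254 : ℕ) : ℝ)⁻¹) with hWdef
  set A : ℝ := Xtot ^ (((2254 : ℕ) : ℝ)⁻¹) with hAdef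
  set B : ℝ := Ytot ^ (((2254 : ℕ) : ℝ)⁻¹) with hBdef
  have hW0 : 0 < W := Real.rpow_pos_of_pos Vtot_pos _
  have hA0 : 0 < A := Real.rpow_pos_of_pos Xtot_pos _
  have hB0 : 0 < B := Real.rpow_pos_of_pos Ytot_pos _
  have hWd : W ^ 2254 = Vtot := Real.rpow_inv_natCast_pow Vtot_pos.le (by norm_num)
  have hAd : A ^ 2254 = Xtot := Real.rpow_inv_natCast_pow Xtot_pos.le (by norm_num)
  have hBd : B ^ 2254 = Ytot := Real.rpow_inv_natCast_pow Ytot_pos.le (by norm_num)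
  have hblk : HasFormatValue (blockOf lvl2Word) (W ^ 2254) (A ^ 2254) (B ^ 2254) (A ^ 2254) := by
    rw [hWd, hAd, hBd]; exact hasFormatValue_lvl2Word
  -- the laser method on the valued word
  have hT := laserMethod_hasFormatValue_of_wordValue (bigCwSq ℂ 5) cwLev2 cwLev2 cwLev2
    cwSupport₂ (bigCwSq_cwSupport₂ ℂ 5) cwTight₂ cwTight₂ cwTight₂γ cwTight₂_injective
    cwTight₂_injective cwTight₂γ_injective cwTight₂_bound cwTight₂_bound cwTight₂_sum
    (by norm_num : 0 < 2254) lvl2Word lvl2Word_mem lvl2Law lvl2Law_eq hW0 hA0.le hB0.le hA0.le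
    hblk
  rw [maxEntropyPenalty_lvl2Law, sub_zero, min_entropy_lvl2Law] at hT
  -- logarithms of the roots
  have hlogW : Real.log W = (2254 : ℝ)⁻¹ * (213 * ((2 + 2 * H3) * Real.log 2)) := by
    rw [hWdef, Real.log_rpow Vtot_pos, Vtot, one_mul, Real.log_pow,
      Real.log_rpow (by norm_num : (0 : ℝ) < 2)]
    push_cast; ring
  have hlogA : Real.log A = (2254 : ℝ)⁻¹ *
      (247 * Real.log 10 + 408 * Real.log 27 + 213 * (77 / 27 * Real.log 5)) := by
    rw [hAdef, Real.log_rpow Xtot_pos, Xtot, Real.log_mul (by positivity) (by positivity),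
      Real.log_mul (by positivity) (by positivity), Real.log_pow, Real.log_pow, Real.log_pow,
      Real.log_rpow (by norm_num : (0 : ℝ) < 5)]
    push_cast; ring
  have hlogB : Real.log B = (2254 : ℝ)⁻¹ *
      (6 * Real.log 10 + 36 * Real.log 27 + 213 * (58 / 27 * Real.log 5)) := by
    rw [hBdef, Real.log_rpow Ytot_pos, Ytot, Real.log_mul (by positivity) (by positivity),
      Real.log_mul (by positivity) (by positivity), Real.log_pow, Real.log_pow, Real.log_pow,
      Real.log_rpow (by norm_num : (0 : ℝ) < 5)]
    push_cast; ring
  have l10 : Real.log 10 = Real.log 2 + Real.log 5 := by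
    rw [show (10 : ℝ) = 2 * 5 by norm_num, Real.log_mul (by norm_num) (by norm_num)]
  have l27 : Real.log 27 = 3 * Real.log 3 := by
    rw [show (27 : ℝ) = 3 ^ 3 by norm_num, Real.log_pow]; norm_num
  have l25 : Real.log 25 = 2 * Real.log 5 := by
    rw [show (25 : ℝ) = 5 ^ 2 by norm_num, Real.log_pow]; norm_num
  -- (1) exact saturation of the packing bound: `2^{H_x} · W · A² = 49 ≥ R̃(CW_5^{⊗2})`
  have e1 := entropy₁_lvl2Law
  have e3 := H3_mul_log_two
  have heq : (2 : ℝ) ^ shannonEntropy (marginalDist₁ lvl2Law) * W * A ^ (2 : ℝ) = 49 := by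
    have hpos : 0 < (2 : ℝ) ^ shannonEntropy (marginalDist₁ lvl2Law) * W * A ^ (2 : ℝ) := by
      positivity
    refine Real.log_injOn_pos (Set.mem_Ioi.2 hpos) (Set.mem_Ioi.2 (by norm_num)) ?_
    rw [Real.log_mul (by positivity) (by positivity), Real.log_mul (by positivity) (by positivity),
      Real.log_rpow (by norm_num : (0 : ℝ) < 2), Real.log_rpow hA0, hlogW, hlogA]
    rw [l10] at e1 ⊢
    rw [l25] at e3
    linear_combination e1 + (426 / 2254) * e3
  have hsat : asymptoticRank (bigCwSq ℂ 5) ≤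
      (2 : ℝ) ^ shannonEntropy (marginalDist₁ lvl2Law) * W * A ^ (2 : ℝ) := by
    rw [heq]; exact asymptoticRank_bigCwSq_five_le
  -- (2) the format inequality `A^{3/10} ≤ B`
  have hAB : A ^ ((3 : ℝ) / 10) ≤ B := by
    rw [← Real.log_le_log_iff (Real.rpow_pos_of_pos hA0 _) hB0, Real.log_rpow hA0, hlogA, hlogB]
    have hc : ((2 : ℕ) ^ 18387 * 3 ^ 69984 : ℝ) ≤ (5 : ℕ) ^ 55950 := by
      exact_mod_cast cert_format
    push_cast at hc
    have hc' := Real.log_le_log (by positivity) hc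
    rw [Real.log_mul (by positivity) (by positivity)] at hc'
    simp only [Real.log_pow, Nat.cast_ofNat] at hc'
    rw [l10, l27]
    linarith
  -- (3) `A > 1`
  have hX1 : 1 < Xtot := by
    unfold Xtot
    have h1 : (1 : ℝ) < 10 ^ 247 * 27 ^ 408 := by norm_num
    have h2 : (1 : ℝ) ≤ ((5 : ℝ) ^ ((77 : ℝ) / 27)) ^ 213 :=
      one_le_pow₀ (Real.one_le_rpow (by norm_num) (by norm_num))
    exact one_lt_mul_of_lt_of_le h1 h2
  have hA1 : 1 < A := Real.one_lt_rpow hX1 (by positivity)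
  exact omegaRect_one_mid_one_le_two_of_hasFormatValue hT hA1 (by norm_num) hAB (by positivity) hsat

/-- **`ω(1, 3/10, 1) = 2`.** [cite: LeGall2012, §6.1 and Table 2] -/
theorem omegaRect_one_3_10_one : omegaRect ℂ 1 ((3 : ℝ) / 10) 1 = 2 :=
  le_antisymm omegaRect_one_3_10_one_le_two
    (by have := add_le_omegaRect₁₃ ℂ 1 ((3 : ℝ) / 10) 1; linarith)

/-- **`α(ℂ) ≥ 3/10`** — level 2 of the saturation ladder (tree record; was `5/17`).
[cite: LeGall2012, Thm. 1.1 and §6] -/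
theorem alpha_ge_3_10 : (3 : ℝ) / 10 ≤ dualExponentAlpha ℂ :=
  (omegaRect_eq_two_iff_le_dualExponentAlpha ℂ _).1 omegaRect_one_3_10_one

/-- `α(ℂ) ≥ 0.3`. [cite: LeGall2012, Thm. 1.1] -/
theorem dualExponentAlpha_ge_03 : (0.3 : ℝ) ≤ dualExponentAlpha ℂ :=
  le_trans (by norm_num) alpha_ge_3_10

/-- `α(ℂ) > 0.2999`: strictly above the level-1 ceiling `0.29463` of Coppersmith (1997).
[cite: LeGall2012, Thm. 1.1] [cite: Coppersmith1997, §3] -/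
theorem dualExponentAlpha_gt_02999 : (0.2999 : ℝ) < dualExponentAlpha ℂ :=
  lt_of_lt_of_le (by norm_num) alpha_ge_3_10

/-- `ω(1, t, 1) = 2` for every `t ≤ 3/10`. [cite: LeGall2012, Thm. 1.1] -/
theorem omegaRect_one_mid_one_eq_two {t : ℝ} (ht : t ≤ 3 / 10) : omegaRect ℂ 1 t 1 = 2 :=
  (omegaRect_eq_two_iff_le_dualExponentAlpha ℂ t).2 (ht.trans alpha_ge_3_10)


end Summit.MatrixMultiplication.MatrixMultiplication.Theorems.SaturationLadderLevelTwo

end
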